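import Mathlib.RingTheory.Flat.FaithfullyFlat.Basic
import Mathlib.RingTheory.TensorProduct.Basic
import HarnessLib

/-!
# The Amitsur complex in degree zero for MODULES: `0 → N → S ⊗_R N ⇉ S ⊗_R S ⊗_R N` is exact for `R → S` faithfully flat

Topic `Literature/RingTheory/Flat`, namespace `Literature.RingTheory.Flat`.  THEOREMS ONLY; no definition, no named fact, no instance, no notation, no `sorry`.

Grothendieck's faithfully flat descent in degree zero ([SGA1] Exp. VIII Cor. 1.3 / Lemma 1.5; [StacksProject, Tag 023M]
«the Amitsur complex `N → N ⊗_R S → N ⊗_R S ⊗_R S → …` is universally exact for `R → S` faithfully flat»; [GortzWedhorn2020]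
Thm. 14.66): for a commutative ring map `R → S` that is FAITHFULLY FLAT and ANY `R`-module `N`,

* `mk_one_injective` — `n ↦ 1 ⊗ n : N → S ⊗_R N` is injective;
* **`exact_mk_one_sub`** — and `N = {x ∈ S ⊗_R N : x ⊗ 1 = 1 ⊗ x in S ⊗_R S ⊗_R N}`, stated as
  `Function.Exact (mk 1) (lTensor S (mk 1) − mk 1)` with Mathlib's `TensorProduct.mk` / `LinearMap.lTensor` (the two coface maps
  `s ⊗ n ↦ s ⊗ 1 ⊗ n` and `s ⊗ n ↦ 1 ⊗ s ⊗ n`); `mem_range_mk_one_iff` is the element form.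

Proof: after the faithfully flat base change `S ⊗_R –` the complex acquires the contraction `s ⊗ s′ ⊗ x ↦ ss′ ⊗ x` (spelled `rTensor (mul′) ∘ assoc⁻¹`; `contract_tmul`,
`contract_lTensor_mk_one`, `contract_lTensor_lTensor_mk_one`), so it is (split) exact; Mathlib's
`Module.FaithfullyFlat.lTensor_injective_iff_injective` / `lTensor_reflects_exact` pull exactness back.  Mathlib has the case
`N = R` only (`Algebra.TensorProduct.IsEffective.of_faithfullyFlat`).  Written for cell `hodgecm-mathlib` (fpqc descent of
sections of quasi-coherent modules, `AlgebraicGeometry/Morphisms/SectionsFpqcDescent`); HC_CM is proved only modulo the 7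
printed citations until rung 0 closes; nothing here is about HC.

## References
* [SGA1] A. Grothendieck, *SGA 1*, Exp. VIII §1 (descente fidèlement plate), Cor. 1.3, Lemma 1.5.
* [StacksProject] The Stacks Project, Tag 023M (Descent, Lemma 35.3.6).
* [GortzWedhorn2020] U. Görtz, T. Wedhorn, *Algebraic Geometry I*, 2nd ed. (2020), Thm. 14.66, Lemma 14.65.
-/

universe u v w

open TensorProduct

namespace Literature.RingTheory.Flat

variable (R : Type u) (S : Type v) [CommRing R] [CommRing S] [Algebra R S]
variable (P : Type w) [AddCommGroup P] [Module R P]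

/-- The CONTRACTION `S ⊗_R (S ⊗_R P) → S ⊗_R P`, `s ⊗ (s′ ⊗ p) ↦ ss′ ⊗ p` (multiplication of the two `S`-factors, spelled
`rTensor P (mul′) ∘ assoc⁻¹`): the homotopy that splits the base-changed Amitsur complex. [cite: StacksProject, Tag 023M] -/
@[simp]
theorem contract_tmul (s s' : S) (p : P) :
    ((LinearMap.rTensor P (LinearMap.mul' R S)) ∘ₗ (TensorProduct.assoc R S S P).symm.toLinearMap) (s ⊗ₜ[R] (s' ⊗ₜ[R] p)) =
      (s * s') ⊗ₜ[R] p := by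
  simp

/-- `contract ∘ (S ⊗ (1 ⊗ –)) = id`: the contraction is a retraction of the base-changed unit `s ⊗ p ↦ s ⊗ 1 ⊗ p`.
[cite: StacksProject, Tag 023M] -/
theorem contract_lTensor_mk_one (x : S ⊗[R] P) :
    ((LinearMap.rTensor P (LinearMap.mul' R S)) ∘ₗ (TensorProduct.assoc R S S P).symm.toLinearMap)
      (LinearMap.lTensor S (TensorProduct.mk R S P 1) x) = x := by
  induction x using TensorProduct.induction_on with
  | zero => simp
  | tmul s p => simp
  | add x y hx hy => rw [map_add, map_add, hx, hy]

/-- `contract ∘ (S ⊗ d₁) = (1 ⊗ –) ∘ contract` for the first coface `d₁ = S ⊗ (1 ⊗ –) : S ⊗ N → S ⊗ S ⊗ N` (on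
`s ⊗ s′ ⊗ n` both sides give `ss′ ⊗ 1 ⊗ n`). [cite: StacksProject, Tag 023M] -/
theorem contract_lTensor_lTensor_mk_one (N : Type w) [AddCommGroup N] [Module R N] (y : S ⊗[R] (S ⊗[R] N)) :
    ((LinearMap.rTensor (S ⊗[R] N) (LinearMap.mul' R S)) ∘ₗ (TensorProduct.assoc R S S (S ⊗[R] N)).symm.toLinearMap)
        (LinearMap.lTensor S (LinearMap.lTensor S (TensorProduct.mk R S N 1)) y) =
      LinearMap.lTensor S (TensorProduct.mk R S N 1)
        (((LinearMap.rTensor N (LinearMap.mul' R S)) ∘ₗ (TensorProduct.assoc R S S N).symm.toLinearMap) y) := by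
  induction y using TensorProduct.induction_on with
  | zero => simp
  | tmul s z =>
      induction z using TensorProduct.induction_on with
      | zero => simp
      | tmul s' n => simp
      | add z z' hz hz' => simp only [tmul_add, map_add, hz, hz']
  | add x y hx hy => simp only [map_add, hx, hy]

/-- The two coface maps agree on the image of the unit: `(d₁ - d₂) ∘ (1 ⊗ –) = 0`. [cite: StacksProject, Tag 023M] -/
theorem lTensor_mk_one_sub_mk_one_comp (N : Type w) [AddCommGroup N] [Module R N] :
    (LinearMap.lTensor S (TensorProduct.mk R S N 1) - TensorProduct.mk R S (S ⊗[R] N) 1) ∘ₗ TensorProduct.mk R S N 1 = 0 := by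
  ext n
  simp

variable (N : Type w) [AddCommGroup N] [Module R N] [Module.FaithfullyFlat R S]

/-- **`n ↦ 1 ⊗ n : N → S ⊗_R N` is injective** for `R → S` faithfully flat and any `R`-module `N` (after `S ⊗_R –` it has the
retraction `contract`; Mathlib `Module.FaithfullyFlat.lTensor_injective_iff_injective`). [cite: StacksProject, Tag 023M]
[cite: GortzWedhorn2020, Lemma 14.65] -/
theorem mk_one_injective : Function.Injective (TensorProduct.mk R S N 1) := by
  rw [← Module.FaithfullyFlat.lTensor_injective_iff_injective R S]
  intro x y h
  rw [← contract_lTensor_mk_one R S N x, ← contract_lTensor_mk_one R S N y, h]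

/-- **Amitsur exactness in degree zero for modules**: for `R → S` faithfully flat and any `R`-module `N`, an element
`x ∈ S ⊗_R N` with `x ⊗ 1 = 1 ⊗ x` in `S ⊗_R S ⊗_R N` (i.e. killed by `d₁ - d₂`, `d₁ = S ⊗ (1 ⊗ –)`, `d₂ = 1 ⊗ –`) is of the
form `1 ⊗ n` — `Function.Exact (1 ⊗ –) (d₁ - d₂)`.  (After `S ⊗_R –`: `y = contract (d₂ y) = contract (d₁ y) = (1 ⊗ –)(contract y)`;
Mathlib `Module.FaithfullyFlat.lTensor_reflects_exact`.) [cite: SGA1, Exp. VIII Cor. 1.3 and Lemma 1.5]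
[cite: StacksProject, Tag 023M] [cite: GortzWedhorn2020, Thm. 14.66] -/
theorem exact_mk_one_sub :
    Function.Exact (TensorProduct.mk R S N 1)
      (LinearMap.lTensor S (TensorProduct.mk R S N 1) - TensorProduct.mk R S (S ⊗[R] N) 1) := by
  apply Module.FaithfullyFlat.lTensor_reflects_exact R S
  intro y
  constructor
  · intro hy
    rw [LinearMap.lTensor_sub, LinearMap.sub_apply, sub_eq_zero] at hy
    refine ⟨((LinearMap.rTensor N (LinearMap.mul' R S)) ∘ₗ (TensorProduct.assoc R S S N).symm.toLinearMap) y, ?_⟩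
    rw [← contract_lTensor_lTensor_mk_one R S N y, hy]
    exact contract_lTensor_mk_one R S (S ⊗[R] N) y
  · rintro ⟨x, rfl⟩
    rw [← LinearMap.comp_apply, ← LinearMap.lTensor_comp, lTensor_mk_one_sub_mk_one_comp, LinearMap.lTensor_zero,
      LinearMap.zero_apply]

/-- Element form: `x ∈ S ⊗_R N` comes from `N` iff its two images in `S ⊗_R S ⊗_R N` agree.
[cite: StacksProject, Tag 023M] [cite: GortzWedhorn2020, Thm. 14.66] -/
theorem mem_range_mk_one_iff (x : S ⊗[R] N) :
    x ∈ Set.range (TensorProduct.mk R S N 1) ↔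
      LinearMap.lTensor S (TensorProduct.mk R S N 1) x = TensorProduct.mk R S (S ⊗[R] N) 1 x := by
  rw [← (exact_mk_one_sub R S N) x, LinearMap.sub_apply, sub_eq_zero]


omit [Module.FaithfullyFlat R S] in
/-- The first coface in the `(S ⊗_R S) ⊗_R N` spelling: `assoc ((includeLeft ⊗ N) x) = (S ⊗ (1 ⊗ –)) x`.
[cite: StacksProject, Tag 023M] -/
theorem assoc_rTensor_includeLeft (x : S ⊗[R] N) :
    TensorProduct.assoc R S S N
        (LinearMap.rTensor N (Algebra.TensorProduct.includeLeft : S →ₐ[R] S ⊗[R] S).toLinearMap x) =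
      LinearMap.lTensor S (TensorProduct.mk R S N 1) x := by
  induction x using TensorProduct.induction_on with
  | zero => simp
  | tmul s n => simp
  | add x y hx hy => rw [map_add, map_add, map_add, hx, hy]

omit [Module.FaithfullyFlat R S] in
/-- The second coface in the `(S ⊗_R S) ⊗_R N` spelling: `assoc ((includeRight ⊗ N) x) = 1 ⊗ x`.
[cite: StacksProject, Tag 023M] -/
theorem assoc_rTensor_includeRight (x : S ⊗[R] N) :
    TensorProduct.assoc R S S N
        (LinearMap.rTensor N (Algebra.TensorProduct.includeRight : S →ₐ[R] S ⊗[R] S).toLinearMap x) =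
      TensorProduct.mk R S (S ⊗[R] N) 1 x := by
  induction x using TensorProduct.induction_on with
  | zero => simp
  | tmul s n => simp
  | add x y hx hy => rw [map_add, map_add, map_add, hx, hy]

/-- **Amitsur in degree zero, `(S ⊗_R S) ⊗_R N` spelling**: `x ∈ S ⊗_R N` comes from `N` iff
`(includeLeft ⊗ N) x = (includeRight ⊗ N) x` — the form in which the two coface maps arise from the two coprojections
`S ⇉ S ⊗_R S` of a kernel pair `Spec (S ⊗_R S) ⇉ Spec S`. [cite: StacksProject, Tag 023M] [cite: GortzWedhorn2020, Thm. 14.66] -/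
theorem mem_range_mk_one_iff_rTensor (x : S ⊗[R] N) :
    x ∈ Set.range (TensorProduct.mk R S N 1) ↔
      LinearMap.rTensor N (Algebra.TensorProduct.includeLeft : S →ₐ[R] S ⊗[R] S).toLinearMap x =
        LinearMap.rTensor N (Algebra.TensorProduct.includeRight : S →ₐ[R] S ⊗[R] S).toLinearMap x := by
  rw [mem_range_mk_one_iff, ← assoc_rTensor_includeLeft, ← assoc_rTensor_includeRight,
    (TensorProduct.assoc R S S N).injective.eq_iff]

end Literature.RingTheory.Flat
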